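import Literature.NumberTheory.Rogawski1990.StableConjugacyU3
import HarnessLib

/-!
# Re-indexing the `J`-side by the stable classes of the quasi-split group: `Σ_{𝒪′_st ⊂ G′} = Σ_{𝒪_st ⊂ G}` along `𝒪′ ↔ 𝒪`
# (Rogawski 1990, §14.1 p. 232, §14.5 p. 237: «`J(𝒪_st, f′) := … if 𝒪_st occurs in G′, 0 otherwise`»)

Topic `NumberTheory/Rogawski1990`; namespace `Literature.NumberTheory.Rogawski1990`; a DEFINITION with body + theorems; no named
fact, no `sorry`, no instance, no notation.  On top of ★ `StableConjugacyU3` (`StableClass`, `StableClass.Corresponds`, `OccursIn`,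
`eq_of_corresponds_left/right`).

Rogawski indexes the grouped orbital terms of the inner form `G′ = U(H′)` by the stable classes of the QUASI-SPLIT `G = U(H)`
(`H = Φ₃`): [§14.5 p. 237] «`J(𝒪_st, f′) = … Σ_{γ ∈ 𝒞′} Φ(γ, f′)` if `𝒪_st` occurs in `G′`, `0` otherwise», through the injective
correspondence `γ′ ↔ γ` of [§14.1 p. 232].  Given ANY function `J′` on the stable classes of `U(H′)(F)` (e.g. the concrete
`𝒪′ ↦ 𝒪′.orbitalSum Φ_{f′}` of the T1a law), §1 defines its push-forward `StableClass.transferFun J′ : StableClass σ H → S`,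
`𝒪 ↦ J′(𝒪′)` for the unique `𝒪′ ↔ 𝒪` (`0` if none), and §2 proves the re-indexing identity
`Σᶠ_{𝒪} transferFun J′ 𝒪 = Σᶠ_{𝒪′} J′ 𝒪′` (`finsum_transferFun`) under the hypothesis that every class in the support of `J′` OCCURS in
`U(H)` — for `H = Φ₃` quasi-split and semisimple classes this hypothesis is the Kottwitz–Steinberg theorem [Rogawski1990, Thm. 3.2.1]
(not proved here; for congruent forms it is ★ `StableClass.occursIn_of_congr`).  No existence statement is smuggled in: the identity is
exactly as strong as its hypothesis.
-/

noncomputable section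

namespace Literature.NumberTheory.Rogawski1990

open scoped MatrixGroups
open Literature.AlgebraicGeometry.ShimuraVarieties (unitaryGroup)

variable {R : Type*} [CommRing R] {n : Type*} [Fintype n] [DecidableEq n] {σ : R →+* R} {H H' : Matrix n n R}
  {S : Type*} [AddCommMonoid S]

/-! ## §1 The push-forward `J′ ↦ (𝒪 ↦ J′(𝒪′), 𝒪′ ↔ 𝒪)` -/

/-- **Push-forward of a function on the stable classes of `U(H′)(F)` to the stable classes of `U(H)(F)`** along `𝒪′ ↔ 𝒪`:
`transferFun J′ 𝒪 = Σᶠ_{𝒪′ ↔ 𝒪} J′ 𝒪′` — the sum has at most one term (injectivity ★ `eq_of_corresponds_left`), so this is `J′(𝒪′)` for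
the unique corresponding `𝒪′` and `0` if `𝒪` does not occur in `U(H′)` («`0` otherwise»). [cite: Rogawski1990, §14.5 p. 237] -/
def StableClass.transferFun (J' : StableClass σ H' → S) (c : StableClass σ H) : S :=
  ∑ᶠ c' ∈ {c' : StableClass σ H' | c'.Corresponds c}, J' c'

/-- The fibre `{𝒪′ | 𝒪′ ↔ 𝒪}` of a corresponding pair is the singleton `{𝒪′}`. [cite: Rogawski1990, §14.1 p. 232] -/
theorem StableClass.setOf_corresponds_eq_singleton {c' : StableClass σ H'} {c : StableClass σ H} (h : c'.Corresponds c) :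
    {d' : StableClass σ H' | d'.Corresponds c} = {c'} := by
  ext d'
  simp only [Set.mem_setOf_eq, Set.mem_singleton_iff]
  exact ⟨fun hd => StableClass.eq_of_corresponds_left hd h, fun hd => hd ▸ h⟩

/-- `transferFun J′ 𝒪 = J′ 𝒪′` when `𝒪′ ↔ 𝒪`. [cite: Rogawski1990, §14.5 p. 237] -/
theorem StableClass.transferFun_eq_of_corresponds (J' : StableClass σ H' → S) {c' : StableClass σ H'} {c : StableClass σ H}
    (h : c'.Corresponds c) : StableClass.transferFun J' c = J' c' := by
  rw [StableClass.transferFun, StableClass.setOf_corresponds_eq_singleton h, finsum_mem_singleton]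

/-- `transferFun J′ 𝒪 = 0` when `𝒪` does not occur in `U(H′)` («`0` otherwise»). [cite: Rogawski1990, §14.5 p. 237] -/
theorem StableClass.transferFun_eq_zero_of_not_occursIn (J' : StableClass σ H' → S) {c : StableClass σ H} (h : ¬ c.OccursIn H') :
    StableClass.transferFun J' c = 0 := by
  rw [StableClass.transferFun]
  have he : {c' : StableClass σ H' | c'.Corresponds c} = ∅ :=
    Set.eq_empty_of_forall_notMem fun c' hc' => h ⟨c', hc'⟩
  rw [he, finsum_mem_empty]

/-- If `transferFun J′ 𝒪 ≠ 0` then `𝒪` occurs in `U(H′)`, through some `𝒪′` with `J′ 𝒪′ ≠ 0`. [cite: Rogawski1990, §14.5 p. 237] -/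
theorem StableClass.exists_corresponds_of_transferFun_ne_zero (J' : StableClass σ H' → S) {c : StableClass σ H}
    (h : StableClass.transferFun J' c ≠ 0) : ∃ c' : StableClass σ H', c'.Corresponds c ∧ J' c' ≠ 0 := by
  by_contra hne
  apply h
  rw [StableClass.transferFun]
  refine finsum_mem_eq_zero_of_forall_eq_zero fun c' hc' => ?_
  by_contra hJ
  exact hne ⟨c', hc', hJ⟩

/-! ## §2 The re-indexing identity -/

/-- A choice of the corresponding class: for `𝒪′` occurring in `U(H)`, SOME `𝒪 ↔ 𝒪′`… precisely a function `StableClass σ H′ → StableClass σ H`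
picking the (unique) partner where one exists (and the class of `1` elsewhere). [cite: Rogawski1990, §14.1 p. 232] -/
def StableClass.partner (c' : StableClass σ H') : StableClass σ H := by
  classical
  exact if h : ∃ c : StableClass σ H, c'.Corresponds c then h.choose else stableClassOf σ H 1

/-- The partner corresponds, when a partner exists. [cite: Rogawski1990, §14.1 p. 232] -/
theorem StableClass.corresponds_partner {c' : StableClass σ H'} (h : ∃ c : StableClass σ H, c'.Corresponds c) :
    c'.Corresponds (StableClass.partner (H := H) c') := by
  classical
  rw [StableClass.partner, dif_pos h]
  exact h.choose_spec

/-- **`Σ_{𝒪_st ⊂ G} J(𝒪_st, f′) = Σ_{𝒪′_st ⊂ G′} J′(𝒪′_st)`** — re-indexing ANY `J′` (as `finsum`s; no finiteness needed) along the injective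
correspondence, PROVIDED every class in the support of `J′` occurs in `U(H)` (for the quasi-split `U(Φ₃)` and semisimple classes:
Kottwitz–Steinberg, [Rogawski1990, Thm. 3.2.1]; hypothesis `hocc`). [cite: Rogawski1990, §14.5 p. 237] -/
theorem finsum_transferFun (J' : StableClass σ H' → S)
    (hocc : ∀ c' ∈ Function.support J', ∃ c : StableClass σ H, c'.Corresponds c) :
    ∑ᶠ c : StableClass σ H, StableClass.transferFun J' c = ∑ᶠ c' : StableClass σ H', J' c' := by
  rw [← finsum_mem_support (StableClass.transferFun J'), ← finsum_mem_support J']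
  symm
  refine finsum_mem_eq_of_bijOn (StableClass.partner (H := H)) ⟨?_, ?_, ?_⟩ ?_
  · -- maps the support of `J′` into the support of the push-forward
    intro c' hc'
    rw [Function.mem_support] at hc' ⊢
    rwa [StableClass.transferFun_eq_of_corresponds J' (StableClass.corresponds_partner (hocc c' hc'))]
  · -- injective on the support (injectivity of `↔`)
    intro c'₁ h₁ c'₂ h₂ he
    exact StableClass.eq_of_corresponds_left (StableClass.corresponds_partner (hocc c'₁ h₁))
      (he ▸ StableClass.corresponds_partner (hocc c'₂ h₂))
  · -- surjective onto the support of the push-forward (functionality of `↔`)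
    intro c hc
    obtain ⟨c', hc'c, hJ⟩ := StableClass.exists_corresponds_of_transferFun_ne_zero J' hc
    refine ⟨c', hJ, ?_⟩
    exact StableClass.eq_of_corresponds_right (StableClass.corresponds_partner (hocc c' hJ)) hc'c
  · intro c' hc'
    rw [StableClass.transferFun_eq_of_corresponds J' (StableClass.corresponds_partner (hocc c' hc'))]

/-- The push-forward of a finitely supported `J′` is finitely supported. [cite: Rogawski1990, §14.5 p. 237] -/
theorem StableClass.finite_support_transferFun (J' : StableClass σ H' → S) (hfin : (Function.support J').Finite) :
    (Function.support (StableClass.transferFun (H := H) J')).Finite := by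
  classical
  refine (hfin.image (StableClass.partner (H := H))).subset fun c hc => ?_
  obtain ⟨c', hc'c, hJ⟩ := StableClass.exists_corresponds_of_transferFun_ne_zero J' hc
  exact ⟨c', hJ, StableClass.eq_of_corresponds_right (StableClass.corresponds_partner ⟨c, hc'c⟩) hc'c⟩

/-- `𝒪′ ↔ 𝒪` iff `𝒪 ↔ 𝒪′` (the correspondence of stable classes is symmetric in the two forms). [cite: Rogawski1990, §14.1 p. 232] -/
theorem StableClass.corresponds_comm {c' : StableClass σ H'} {c : StableClass σ H} : c'.Corresponds c ↔ c.Corresponds c' := by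
  obtain ⟨γ', rfl⟩ := stableClassOf_surjective c'
  obtain ⟨γ, rfl⟩ := stableClassOf_surjective c
  exact Rogawski1990.corresponds_comm

/-- For CONGRUENT forms (`(g.map σ)ᵀ H g = H′`) every class occurs, so the re-indexing is unconditional. [cite: Rogawski1990, §14.1 p. 232] -/
theorem finsum_transferFun_of_congr (g : GL n R) (hg : ((g : Matrix n n R).map σ).transpose * H * (g : Matrix n n R) = H')
    (J' : StableClass σ H' → S) :
    ∑ᶠ c : StableClass σ H, StableClass.transferFun J' c = ∑ᶠ c' : StableClass σ H', J' c' :=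
  finsum_transferFun J' fun c' _ => by
    obtain ⟨c, hc⟩ := StableClass.occursIn_of_congr (H := H') (H' := H) g hg c'
    exact ⟨c, StableClass.corresponds_comm.mpr hc⟩

end Literature.NumberTheory.Rogawski1990
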